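import Summits.RiemannHypothesis.RiemannHypothesis.Theorems.S2FormatCReduction
import Summits.RiemannHypothesis.RiemannHypothesis.Theorems.WeilFormatCCertificate
import Summits.RiemannHypothesis.RiemannHypothesis.Theorems.WeilFormatCWindowDictionaryTwo
import HarnessLib

/-!
# Format C at `S = {∞, 2}` — THE RUNG THEOREM IN CERTIFICATE SHAPE (weil-10's `weilPositivityOn_of_formatC_certificates`,
# semilocal twin): two sector certificates for the kernel `S2FormatC.gram b` close `b ≤ a*({2})`

Seat cc-s2-4 gen3 (`HOME/cc-s2-4/CC4-LEAN.md` §9.12).  weil-10's per-rung statement `WeilFormatC.weilPositivityOn_of_formatC_certificates`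
(`WeilFormatCCertificate.lean`) turns, for the FULL Weil form, two sector certificates (far diagonal bound L-C3a, coupling
majorant L-C3b, kernel certificate (P) on the sector kernels `M⁺_G`, `M⁻_G` of the Gram kernel `G`) into `WeilPositivityOn a`.
This file is the `S = {∞, 2}` twin with THE SAME HYPOTHESIS SHAPES for `G = S2FormatC.gram b` (`= gramCoeffList b [⟨2,1⟩]`,
`S2FormatCGramYoshida`): the conclusion is `WeilSemilocalPositivityOn {2} b ∧ b ≤ weilSemilocalThreshold {2}`
(`(log 2)/2 ≤ b ≤ log 2`).  Composition: weil-10's generic soundness `sum_range_mul_mul_nonneg_of_certificate_sum` per sector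
(needs `gram_symm`, `gram_refl`) → weil-2's sector split `sum_modes_re_conj_mul_nonneg_of_sectors` → the entry theorem
`entryTheoremTwo_of_pos` → weil-3's dictionary `weilSemilocalPositivityOn_two_of_window_sum_chi_nonneg` → `le_weilSemilocalThreshold`.
So the producers' far-bound files, true-column majorants and (P)/(E) kernel files, all written against `M^±_G` in M-units, plug in
verbatim with `G = gram b`.  Bookkeeping only; standard axioms; no claim about RH.
-/

set_option linter.dupNamespace false
set_option autoImplicit false

noncomputable section

open Complex Set MeasureTheory Filter Finset Matrix
open scoped Real Topology ComplexConjugate BigOperators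

namespace Summit.RiemannHypothesis.RiemannHypothesis.Theorems.S2FormatC

open Literature.NumberTheory.LFunctions Literature.Analysis.SpecialFunctions
open Summit.RiemannHypothesis.RiemannHypothesis.Theorems.MotivicDoor.SemilocalThreshold

section Certificate

variable {b : ℝ}

/-- **Sector kernels of `gram b` nonnegative ⟹ the `S = {2}` rung** (`(log 2)/2 ≤ b ≤ log 2`): if weil-2's even kernel
`M⁺_{G}` and odd kernel `M⁻_{G}` of `G = gram b` are nonnegative real quadratic forms on every `range K`, then
`WeilSemilocalPositivityOn {2} b` and `b ≤ a*({2})`. -/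
theorem le_threshold_of_sectorKernels_nonneg (hb : 0 < b) (hb1 : Real.log 2 ≤ 2 * b) (hb2 : b ≤ Real.log 2)
    (hev : ∀ (K : ℕ) (y : ℕ → ℝ), 0 ≤ ∑ n ∈ range K, ∑ m ∈ range K,
      y n * y m * (if n = 0 then gram b 0 m else if m = 0 then gram b n 0 else (gram b n m + gram b n (-(m : ℤ))) / 2))
    (hod : ∀ (K : ℕ) (z : ℕ → ℝ), 0 ≤ ∑ k ∈ range K, ∑ l ∈ range K,
      z k * z l * ((gram b ((k : ℤ) + 1) ((l : ℤ) + 1) - gram b ((k : ℤ) + 1) (-((l : ℤ) + 1))) / 2)) :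
    WeilSemilocalPositivityOn {2} b ∧ b ≤ weilSemilocalThreshold {2} := by
  have hHerm : ∀ (N : ℕ) (c : ℤ → ℂ),
      0 ≤ ∑ n ∈ Yoshida1992.modes N, ∑ m ∈ Yoshida1992.modes N, (conj (c n) * c m).re * gram b n m :=
    fun N c ↦ WeilFormatC.sum_modes_re_conj_mul_nonneg_of_sectors (G := gram b) (fun n m ↦ gram_refl b n m) N
      (hev (N + 1)) (hod N) c
  have hDict : DictionaryTwo b := by
    intro h
    exact WeilFormatC.weilSemilocalPositivityOn_two_of_window_sum_chi_nonneg hb hb2 fun N c ↦ by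
      have h' := h N c
      unfold windowFormTwo trigWindow lam at h'
      exact h'
  have hPos : WeilSemilocalPositivityOn {2} b :=
    hDict fun N c ↦ by rw [entryTheoremTwo_of_pos hb hb1 N c]; exact hHerm N c
  exact ⟨hPos, le_weilSemilocalThreshold hPos⟩

/-- **Format C at `S = {2}`: two sector certificates ⟹ the rung** — the semilocal twin of weil-10's
`WeilFormatC.weilPositivityOn_of_formatC_certificates`, same hypothesis shapes with `G = gram b`.  For the EVEN sector: a block
size `Be`, a far diagonal `de > 0` on `m ≥ Be`, a real `Be × Be` matrix `Ue` with
(L-C3a) `Σ_{Be≤n<N} de_n y_n² ≤ Σ_{Be≤n,m<N} y_n M⁺(n,m) y_m` for all `N, y`;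
(L-C3b) `Σ_{Be≤m<N} (Σ_{i<Be} M⁺(i,m) x_i)²/de_m ≤ xᵀUe x` for all `N, x`;
(P)+(E) `0 ≤ Σ_{i,j<Be} x_i x_j (M⁺(i,j) − Ue_{ij})` for all `x` — and the same three for the ODD sector.  Then
`WeilSemilocalPositivityOn {2} b ∧ b ≤ weilSemilocalThreshold {2}` (`(log 2)/2 ≤ b ≤ log 2`). -/
theorem le_threshold_of_formatC_certificates (hb : 0 < b) (hb1 : Real.log 2 ≤ 2 * b) (hb2 : b ≤ Real.log 2)
    -- even sector
    (Be : ℕ) (de : ℕ → ℝ) (Ue : Matrix (Fin Be) (Fin Be) ℝ) (hde : ∀ m, Be ≤ m → 0 < de m)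
    (hfar_e : ∀ (N : ℕ) (y : ℕ → ℝ),
      ∑ n ∈ Ico Be N, de n * y n ^ 2 ≤ ∑ n ∈ Ico Be N, ∑ m ∈ Ico Be N,
        y n * (if n = 0 then gram b 0 m else if m = 0 then gram b n 0 else (gram b n m + gram b n (-(m : ℤ))) / 2) * y m)
    (hU_e : ∀ (N : ℕ) (x : Fin Be → ℝ),
      ∑ m ∈ Ico Be N, (∑ i : Fin Be,
        (if (i : ℕ) = 0 then gram b 0 m else if m = 0 then gram b i 0 else (gram b i m + gram b i (-(m : ℤ))) / 2) * x i) ^ 2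
          / de m ≤ x ⬝ᵥ Ue *ᵥ x)
    (hS_e : ∀ x : Fin Be → ℝ, 0 ≤ ∑ i, ∑ j, x i * x j *
      ((if (i : ℕ) = 0 then gram b 0 j else if (j : ℕ) = 0 then gram b i 0 else (gram b i j + gram b i (-(j : ℤ))) / 2)
        - Ue i j))
    -- odd sector
    (Bo : ℕ) (dodd : ℕ → ℝ) (Uo : Matrix (Fin Bo) (Fin Bo) ℝ) (hdo : ∀ m, Bo ≤ m → 0 < dodd m)
    (hfar_o : ∀ (N : ℕ) (z : ℕ → ℝ),
      ∑ k ∈ Ico Bo N, dodd k * z k ^ 2 ≤ ∑ k ∈ Ico Bo N, ∑ l ∈ Ico Bo N,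
        z k * ((gram b ((k : ℤ) + 1) ((l : ℤ) + 1) - gram b ((k : ℤ) + 1) (-((l : ℤ) + 1))) / 2) * z l)
    (hU_o : ∀ (N : ℕ) (x : Fin Bo → ℝ),
      ∑ l ∈ Ico Bo N, (∑ i : Fin Bo,
        ((gram b ((i : ℤ) + 1) ((l : ℤ) + 1) - gram b ((i : ℤ) + 1) (-((l : ℤ) + 1))) / 2) * x i) ^ 2
          / dodd l ≤ x ⬝ᵥ Uo *ᵥ x)
    (hS_o : ∀ x : Fin Bo → ℝ, 0 ≤ ∑ i, ∑ j, x i * x j *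
      ((gram b ((i : ℤ) + 1) ((j : ℤ) + 1) - gram b ((i : ℤ) + 1) (-((j : ℤ) + 1))) / 2 - Uo i j)) :
    WeilSemilocalPositivityOn {2} b ∧ b ≤ weilSemilocalThreshold {2} := by
  refine le_threshold_of_sectorKernels_nonneg hb hb1 hb2 (fun K y ↦ ?_) (fun K z ↦ ?_)
  · exact WeilFormatC.sum_range_mul_mul_nonneg_of_certificate_sum
      (fun n m : ℕ ↦ if n = 0 then gram b 0 m else if m = 0 then gram b n 0 else (gram b n m + gram b n (-(m : ℤ))) / 2)
      (fun n m ↦ WeilFormatC.evenKernel_symm (gram b) (gram_symm b) (gram_refl b) n m) Be de Ue hde hfar_e hU_e hS_e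
      K y
  · exact WeilFormatC.sum_range_mul_mul_nonneg_of_certificate_sum
      (fun k l : ℕ ↦ (gram b ((k : ℤ) + 1) ((l : ℤ) + 1) - gram b ((k : ℤ) + 1) (-((l : ℤ) + 1))) / 2)
      (fun k l ↦ WeilFormatC.oddKernel_symm (gram b) (gram_symm b) (gram_refl b) k l) Bo dodd Uo hdo hfar_o hU_o
      hS_o K z

end Certificate

end Summit.RiemannHypothesis.RiemannHypothesis.Theorems.S2FormatC

end
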